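import Literature.AnabelianGeometry.SemiGraphs.CoveringGraphIsoOverOfIso
import Literature.AnabelianGeometry.SemiGraphs.CoveringGraphGaloisCountableFinite
import Literature.AnabelianGeometry.SemiGraphs.Prop44iEmbeddingTransport
import Literature.AnabelianGeometry.SemiGraphs.FiniteEtaleCoveringComp
import HarnessLib

/-!
# [SemiAnbd] §2 p.23 / Def 3.5 (i) / Prop 3.6 (v) at the `B^cov` carriers: a TOWER of coverings `𝒢_{T′} → 𝒢_{S₀} → K` IS the
# covering of ONE object of `B^cov(K)` — `𝒢_{U} ≅ 𝒢_{T′}` over `K` for `U → S₀` with `toCovering U ≅ T′`; Prop 4.4 (i) with ONE `K̃ = 𝒢_S`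

Mochizuki, *Semi-graphs of anabelioids*, Publ. RIMS **42** (2006), §2 p. 23 (for `G′ ∈ Ob(B(G))` the finite étale covering
`B′ = B(G)_{G′} → B(G)` «itself arises naturally as the `B(−)` of some connected semi-graph of anabelioids `𝒢′` equipped with
a morphism `𝒢′ → 𝒢`» — so objects of `B(𝒢′) = B(𝒢)_{𝒢′}` are objects of `B(𝒢)` over `G′`: a covering of a covering is a
covering), §3 p. 37 / Def 3.5 (i) (the covering `𝒢_S → 𝒢` of `S ∈ B^cov(G)`), Prop 3.6 (v) p. 39 (`B^temp(G′)` is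
`B^temp(G)_{G′}`; at the `B^cov` level abc-iut-L3-d6's `CovObj.coveringEquiv : Over S ≌ CovObj 𝒢_S`), Prop 4.4 (i) p. 54
(«there exists a finite étale covering `K′ → K` of `K` such that …»; print's `K′`, `H′` are written `K̃`, `H̃` below to avoid a
clash with the primed semi-graph variables of this file) (kurims `paper:url-f33ace170ff4`). [cite: MochizukiSemiAnbd2006, Def 3.5(i) p.37]

PROOF-ONLY (cell abc-iut, layer L3, seat abc-iut-f-161 gen 9, row «(2e) TOWER ⇒ ONE COVERING» (II′), L3-lead g9 GO 12:4xZ; no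
definition, no instance, no named fact).  For `S₀ ∈ B^cov(K)`, an object `U → S₀` of `B^cov(K)` over `S₀`, and `T′ ∈ B^cov(𝒢_{S₀})`
with `φ : toCovering U ≅ T′` (abc-iut-L3-d6 `CovObj.toCovering`), the covering `𝒢_{U} → K` of the TOTAL object `U.left` and the
TOWER `𝒢_{T′} → 𝒢_{S₀} → K` are ISOMORPHIC OVER `K` (abc-iut-L3-t3's `Hom.IsoOver`): `CovObj.nonempty_isoOver_tower`.  The
isomorphism is abc-iut-L3-t3's `CovObj.pointIsoOver` for the tower `p := 𝒢_{T′} → 𝒢_{S₀} → K` and the point system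
`y_{((v,ω),o)} := (φ⁻¹ x_o).1 ∈ U_v` (a point of the point fibre of `U_v → S₀,v` over the base point `x_ω`, read in `U_v`):
§1 the stabiliser dictionary (PS2) — the tower's constituent at `((v,ω),o)` is `Stab_{Stab(x_ω)}(x_o) ↪ Stab(x_ω) ↪ Π_v`, with
image `Stab_{Π_v}(y)`; §2 the incidence computation `glue_U(z) = c₁⁻¹ · c₂⁻¹ · y` (`c₁`, `c₂` the incidence conjugators of `𝒢_{S₀}`
and `𝒢_{T′}`; abc-iut-L3-d6's `toCoveringGlue_apply`) giving (PS1) and (PS3) with `k := c₂ c₁`; §3 bijectivity of the point lift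
(properness of the tower: `isProper_coveringHom` twice + abc-iut-f-161 g0's `SemiGraph.IsProper.comp`);
§4 ★ `nonempty_isoOver_tower`, ★ `exists_covObj_isoOver_tower` — with `U := pre T′` (d6's essential preimage, `preIso`): EVERY
tower `𝒢_{T′} → 𝒢_{S₀} → K` is isomorphic over `K` to `𝒢_S → K` for ONE `S ∈ B^cov(K)`, FINITE when `S₀`, `T′` are (abc-iut-L3-t5
`isFinite_pre`) — «a covering of a covering is a covering» (§2 p.23 `B(𝒢′) = B(𝒢)_{𝒢′}` / Prop 3.6 (v)) at the `B^cov` carriers;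
§5 ★★ `Hom.prop44i_oneObject_of_isQuasiCoherent` — abc-iut-f-161's Prop 4.4 (i) (`prop44i_embedding_of_isQuasiCoherent`) with the
tower REPACKAGED: the `K̃` of print is `𝒢_S → K` for one finite `S ∈ B^cov(K)`, isomorphic over `K` to `𝒢_{S_π} → 𝒢_{S₀} → K`.
WHAT IS NOT CLAIMED: the components `H̃` are still read through the tower (as the connected pieces of `𝔾''_{ψ₀^*S_π}`, mapped by
`𝒢''_{ψ₀^*S_π} → 𝒢_{S_π} ≅ 𝒢_S`); the PASTING identification `𝒢'_{ψ^*S} ≅ 𝒢''_{ψ₀^*S_π}` of the pull-back of `S` itself with the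
iterated pull-back (two fibre squares compose to one) is not typed here; nor is the `Loc(𝔾, Γ)` dressing.
Nothing printed is asserted; no side taken on [IUTchIII] Cor. 3.12.
-/

noncomputable section

namespace Literature.AnabelianGeometry.SemiGraphs

open CategoryTheory
open Literature.AlgebraicGeometry.Frobenioids.QuasiTemperoid.BTempConnected (hom_ρ ρ_one_apply
  ρ_mul_apply ρ_inv_apply)

universe u

namespace ProfiniteSemiGraph

namespace CovObj

variable {K : ProfiniteSemiGraph.{u}} (S₀ : CovObj K) (U : Over S₀) {T' : CovObj S₀.coveringGraph}
  (φ : S₀.toCovering.obj U ≅ T')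

/-! ## §0. Points of the point fibres; the point system -/

/-- A point of `(toCovering U)_{(v,ω)}` (the point fibre of `U_v → S₀,v` over `x_ω`) lies over `x_ω`. [cite: MochizukiSemiAnbd2006, Def 3.5(i) p.37] -/
theorem toCovering_pt_over (v : K.graph.Vertex) (ω : BTemp.Orbits (S₀.SV v))
    (t : ((S₀.toCovering.obj U).SV ⟨v, ω⟩).obj.V) : ((U.hom.fV v).hom.hom t.1 : (S₀.SV v).obj.V) = Quot.out ω :=
  t.2

/-- … edge version. [cite: MochizukiSemiAnbd2006, Def 3.5(i) p.37] -/
theorem toCovering_ptE_over (f : K.graph.Edge) (ω : BTemp.Orbits (S₀.SE f))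
    (t : ((S₀.toCovering.obj U).SE ⟨f, ω⟩).obj.V) : ((U.hom.fE f).hom.hom t.1 : (S₀.SE f).obj.V) = Quot.out ω :=
  t.2

/-- The action of `Stab(x_ω)` on the point fibre is the action of `Π_v` on `U_v`. [cite: MochizukiSemiAnbd2006, Def 3.5(i) p.37] -/
theorem toCovering_ρV_val (v : K.graph.Vertex) (ω : BTemp.Orbits (S₀.SV v)) (s : BTemp.stab (S₀.SV v) (Quot.out ω))
    (t : ((S₀.toCovering.obj U).SV ⟨v, ω⟩).obj.V) :
    (((S₀.toCovering.obj U).SV ⟨v, ω⟩).obj.ρ s t).1 = (U.left.SV v).obj.ρ (s : K.Gv v) t.1 := rfl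

/-- … edge version. [cite: MochizukiSemiAnbd2006, Def 3.5(i) p.37] -/
theorem toCovering_ρE_val (f : K.graph.Edge) (ω : BTemp.Orbits (S₀.SE f)) (s : BTemp.stab (S₀.SE f) (Quot.out ω))
    (t : ((S₀.toCovering.obj U).SE ⟨f, ω⟩).obj.V) :
    (((S₀.toCovering.obj U).SE ⟨f, ω⟩).obj.ρ s t).1 = (U.left.SE f).obj.ρ (s : K.Ge f) t.1 := rfl

/-- An element of `Π_v` fixing a point of `U_v` over `x_ω` fixes `x_ω`. [cite: MochizukiSemiAnbd2006, Rem. 2.2.1 p.24] -/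
theorem mem_stab_of_ρ_val_eq (v : K.graph.Vertex) (ω : BTemp.Orbits (S₀.SV v))
    (t : ((S₀.toCovering.obj U).SV ⟨v, ω⟩).obj.V) (g : K.Gv v) (hg : (U.left.SV v).obj.ρ g t.1 = t.1) :
    g ∈ BTemp.stab (S₀.SV v) (Quot.out ω) := by
  change (S₀.SV v).obj.ρ g (Quot.out ω) = Quot.out ω
  rw [← S₀.toCovering_pt_over U v ω t, ← hom_ρ, hg]

/-- … edge version. [cite: MochizukiSemiAnbd2006, Rem. 2.2.1 p.24] -/
theorem mem_stabE_of_ρ_val_eq (f : K.graph.Edge) (ω : BTemp.Orbits (S₀.SE f))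
    (t : ((S₀.toCovering.obj U).SE ⟨f, ω⟩).obj.V) (g : K.Ge f) (hg : (U.left.SE f).obj.ρ g t.1 = t.1) :
    g ∈ BTemp.stab (S₀.SE f) (Quot.out ω) := by
  change (S₀.SE f).obj.ρ g (Quot.out ω) = Quot.out ω
  rw [← S₀.toCovering_ptE_over U f ω t, ← hom_ρ, hg]

/-! ## §1. (PS2) The stabiliser dictionary for the tower -/

/-- **(PS2) for the tower `𝒢_{T′} → 𝒢_{S₀} → K`** with points `y_{((v,ω),o)} := (φ⁻¹ x_o).1`: the constituents are injective
with image the stabilisers. [cite: MochizukiSemiAnbd2006, Rem. 2.2.1 p.24] -/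
theorem stabCondition_tower :
    StabCondition (T'.coveringHom.comp S₀.coveringHom) U.left
      (fun ν => ((φ.inv.fV ν.1).hom.hom (Quot.out ν.2)).1)
      (fun ε => ((φ.inv.fE ε.1).hom.hom (Quot.out ε.2)).1) := by
  refine ⟨fun ν => Subtype.val_injective.comp Subtype.val_injective, fun ν => ?_,
    fun ε => Subtype.val_injective.comp Subtype.val_injective, fun ε => ?_⟩
  · obtain ⟨⟨v, ω⟩, o⟩ := ν
    ext g
    constructor
    · rintro ⟨s, rfl⟩
      -- `s ∈ Stab_{Stab(x_ω)}(x_o)`: `s` fixes `φ⁻¹ x_o`, hence its underlying point of `U_v`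
      change (U.left.SV v).obj.ρ (s.1 : K.Gv v) ((φ.inv.fV ⟨v, ω⟩).hom.hom (Quot.out o)).1 =
        ((φ.inv.fV ⟨v, ω⟩).hom.hom (Quot.out o)).1
      rw [← toCovering_ρV_val, ← hom_ρ, show (T'.SV ⟨v, ω⟩).obj.ρ s.1 (Quot.out o) = Quot.out o from s.2]
    · intro hg
      have hg' : g ∈ BTemp.stab (S₀.SV v) (Quot.out ω) := S₀.mem_stab_of_ρ_val_eq U v ω _ g hg
      have hs : (⟨g, hg'⟩ : BTemp.stab (S₀.SV v) (Quot.out ω)) ∈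
          BTemp.stab (T'.SV ⟨v, ω⟩) (Quot.out o) := by
        rw [← iso_hom_inv_apply_V φ ⟨v, ω⟩ (Quot.out o), stab_iso_hom_V]
        exact Subtype.ext hg
      exact ⟨⟨⟨g, hg'⟩, hs⟩, rfl⟩
  · obtain ⟨⟨f, ω⟩, o⟩ := ε
    ext g
    constructor
    · rintro ⟨s, rfl⟩
      change (U.left.SE f).obj.ρ (s.1 : K.Ge f) ((φ.inv.fE ⟨f, ω⟩).hom.hom (Quot.out o)).1 =
        ((φ.inv.fE ⟨f, ω⟩).hom.hom (Quot.out o)).1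
      rw [← toCovering_ρE_val, ← hom_ρ, show (T'.SE ⟨f, ω⟩).obj.ρ s.1 (Quot.out o) = Quot.out o from s.2]
    · intro hg
      have hg' : g ∈ BTemp.stab (S₀.SE f) (Quot.out ω) := S₀.mem_stabE_of_ρ_val_eq U f ω _ g hg
      have hs : (⟨g, hg'⟩ : BTemp.stab (S₀.SE f) (Quot.out ω)) ∈
          BTemp.stab (T'.SE ⟨f, ω⟩) (Quot.out o) := by
        rw [← iso_hom_inv_apply_E φ ⟨f, ω⟩ (Quot.out o), stab_iso_hom_E]
        exact Subtype.ext hg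
      exact ⟨⟨⟨g, hg'⟩, hs⟩, rfl⟩

/-! ## §2. The incidence computation: (PS1) and (PS3) -/

/-- **The incidence computation.**  Along the branch-orbit `β = ((b,ω_e),o_b)` of `𝔾_{T′}` abutting to `ν = ((v,ω_v),o)`, with
`c₁`, `c₂` the incidence conjugators of `𝒢_{S₀}` at `(b,ω_e) ↦ (v,ω_v)` and of `𝒢_{T′}` at `β ↦ ν`:
`c₂ · c₁ · glue_U((φ⁻¹ x_{o_b}).1) = (φ⁻¹ x_o).1` in `U_v` (d6's `toCoveringGlue_apply`, `φ⁻¹` commuting with the gluings, and the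
defining properties of `c₁`, `c₂`). [cite: MochizukiSemiAnbd2006, Def 3.5(i) p.37] -/
theorem ρ_glue_tower_eq {b : K.graph.Branch} {ωe : BTemp.Orbits (S₀.SE (K.graph.edgeOf b))}
    {ob : BTemp.Orbits (T'.SE ⟨K.graph.edgeOf b, ωe⟩)} {v : K.graph.Vertex} {ωv : BTemp.Orbits (S₀.SV v)}
    {o : BTemp.Orbits (T'.SV ⟨v, ωv⟩)}
    (h : T'.coveringSemiGraph.abuts ⟨⟨b, ωe⟩, ob⟩ = some ⟨⟨v, ωv⟩, o⟩) :
    (U.left.SV v).obj.ρ ((T'.conjugator h : BTemp.stab (S₀.SV v) (Quot.out ωv)) : K.Gv v)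
      ((U.left.SV v).obj.ρ (S₀.conjugator (T'.abuts_of_coveringAbuts h))
        ((U.left.glue b v (S₀.abuts_of_coveringAbuts (T'.abuts_of_coveringAbuts h))).hom.hom.hom
          ((φ.inv.fE ⟨K.graph.edgeOf b, ωe⟩).hom.hom (Quot.out ob)).1)) =
      ((φ.inv.fV ⟨v, ωv⟩).hom.hom (Quot.out o)).1 := by
  have h₁ := T'.abuts_of_coveringAbuts h
  have hc₂ := T'.conjugator_spec h
  -- the gluing of `toCovering U` is `c₁ · glue_U` on points (d6), and `φ⁻¹` commutes with the gluings
  have hφ : (((S₀.toCovering.obj U).glue ⟨b, ωe⟩ ⟨v, ωv⟩ h₁).hom.hom.hom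
        ((φ.inv.fE ⟨K.graph.edgeOf b, ωe⟩).hom.hom (Quot.out ob)) : ((S₀.toCovering.obj U).SV ⟨v, ωv⟩).obj.V) =
      (φ.inv.fV ⟨v, ωv⟩).hom.hom ((T'.glue ⟨b, ωe⟩ ⟨v, ωv⟩ h₁).hom.hom.hom (Quot.out ob)) :=
    glue_iso_hom_apply φ.symm ⟨b, ωe⟩ ⟨v, ωv⟩ h₁ (Quot.out ob)
  have hglue : (U.left.SV v).obj.ρ (S₀.conjugator h₁)
      ((U.left.glue b v (S₀.abuts_of_coveringAbuts h₁)).hom.hom.hom ((φ.inv.fE ⟨K.graph.edgeOf b, ωe⟩).hom.hom (Quot.out ob)).1) =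
      ((φ.inv.fV ⟨v, ωv⟩).hom.hom ((T'.glue ⟨b, ωe⟩ ⟨v, ωv⟩ h₁).hom.hom.hom (Quot.out ob))).1 := by
    rw [← hφ]
    rfl
  rw [hglue, ← toCovering_ρV_val, ← hom_ρ, hc₂]

/-- **(PS1) gluing condition** for the tower's point system. [cite: MochizukiSemiAnbd2006, Def 3.5(i) p.37] -/
theorem glueCondition_tower :
    U.left.GlueCondition (T'.coveringHom.comp S₀.coveringHom).base
      (fun ν => ((φ.inv.fV ν.1).hom.hom (Quot.out ν.2)).1)
      (fun ε => ((φ.inv.fE ε.1).hom.hom (Quot.out ε.2)).1) := by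
  refine ⟨fun β ν h => ?_⟩
  obtain ⟨⟨b, ωe⟩, ob⟩ := β
  obtain ⟨⟨v, ωv⟩, o⟩ := ν
  have key := S₀.ρ_glue_tower_eq U φ h
  change BTemp.cl (U.left.SV v) ((U.left.glue b v _).hom.hom.hom
      (U.left.castPtE _ ((φ.inv.fE ⟨K.graph.edgeOf b, ωe⟩).hom.hom (Quot.out ob)).1)) =
    BTemp.cl (U.left.SV v) ((φ.inv.fV ⟨v, ωv⟩).hom.hom (Quot.out o)).1
  rw [← key, BTemp.cl_ρ, BTemp.cl_ρ]
  rfl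

/-- **(PS3) point alignment** for the tower's point system, with the aligned conjugator `k := c₂ · c₁`.
[cite: MochizukiSemiAnbd2006, Def 3.5(i) p.37] -/
theorem pointAligned_tower :
    PointAligned (T'.coveringHom.comp S₀.coveringHom) U.left
      (fun ν => ((φ.inv.fV ν.1).hom.hom (Quot.out ν.2)).1)
      (fun ε => ((φ.inv.fE ε.1).hom.hom (Quot.out ε.2)).1) := by
  refine ⟨fun β ν h => ?_⟩
  obtain ⟨⟨b, ωe⟩, ob⟩ := β
  obtain ⟨⟨v, ωv⟩, o⟩ := ν
  have key := S₀.ρ_glue_tower_eq U φ h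
  refine ⟨((T'.conjugator h : BTemp.stab (S₀.SV v) (Quot.out ωv)) : K.Gv v) *
    S₀.conjugator (T'.abuts_of_coveringAbuts h), fun x => ?_, ?_⟩
  · change ((T'.conjugator h : BTemp.stab (S₀.SV v) (Quot.out ωv)) : K.Gv v) *
        (S₀.conjugator (T'.abuts_of_coveringAbuts h) *
          K.brHom b v (S₀.abuts_of_coveringAbuts (T'.abuts_of_coveringAbuts h)) ((x.1 : K.Ge (K.graph.edgeOf b))) *
          (S₀.conjugator (T'.abuts_of_coveringAbuts h))⁻¹) *
        (((T'.conjugator h : BTemp.stab (S₀.SV v) (Quot.out ωv)) : K.Gv v))⁻¹ =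
      ((T'.conjugator h : BTemp.stab (S₀.SV v) (Quot.out ωv)) : K.Gv v) * S₀.conjugator (T'.abuts_of_coveringAbuts h) *
        K.brHom b v (S₀.abuts_of_coveringAbuts (T'.abuts_of_coveringAbuts h)) ((x.1 : K.Ge (K.graph.edgeOf b))) *
        (((T'.conjugator h : BTemp.stab (S₀.SV v) (Quot.out ωv)) : K.Gv v) * S₀.conjugator (T'.abuts_of_coveringAbuts h))⁻¹
    simp only [mul_assoc, mul_inv_rev]
  · change (U.left.SV v).obj.ρ (((T'.conjugator h : BTemp.stab (S₀.SV v) (Quot.out ωv)) : K.Gv v) *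
        S₀.conjugator (T'.abuts_of_coveringAbuts h))
        ((U.left.glue b v _).hom.hom.hom
          (U.left.castPtE _ ((φ.inv.fE ⟨K.graph.edgeOf b, ωe⟩).hom.hom (Quot.out ob)).1)) =
      ((φ.inv.fV ⟨v, ωv⟩).hom.hom (Quot.out o)).1
    rw [ρ_mul_apply, ← key]
    rfl

/-! ## §3. Bijectivity of the point lift `𝔾_{T′} → 𝔾_U` -/

/-- The point lift of the tower's point system is bijective on vertices: `((v,ω),o) ↦ (v, [(φ⁻¹ x_o).1])`.
[cite: MochizukiSemiAnbd2006, §2 p.23] -/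
theorem pointLift_tower_vertexMap_bijective :
    Function.Bijective (U.left.pointLift (T'.coveringHom.comp S₀.coveringHom).base
      (fun ν => ((φ.inv.fV ν.1).hom.hom (Quot.out ν.2)).1)
      (fun ε => ((φ.inv.fE ε.1).hom.hom (Quot.out ε.2)).1) (S₀.glueCondition_tower U φ)).vertexMap := by
  constructor
  · rintro ⟨⟨v, ω⟩, o⟩ ⟨⟨v', ω'⟩, o'⟩ hνν
    rw [pointLift_vertexMap, pointLift_vertexMap] at hνν
    obtain ⟨h1, h2⟩ := Sigma.mk.inj_iff.mp hνν
    change v = v' at h1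
    subst h1
    have h3 := eq_of_heq h2
    change BTemp.cl (U.left.SV v) ((φ.inv.fV ⟨v, ω⟩).hom.hom (Quot.out o)).1 =
      BTemp.cl (U.left.SV v) ((φ.inv.fV ⟨v, ω'⟩).hom.hom (Quot.out o')).1 at h3
    obtain ⟨g, hg⟩ := (BTemp.cl_eq_cl_iff _ _ _).mp h3
    -- under `U_v → S₀,v`: `g · x_ω = x_{ω′}`, so `ω = ω′`
    have e1 := congrArg (fun t : (U.left.SV v).obj.V => ((U.hom.fV v).hom.hom t : (S₀.SV v).obj.V)) hg
    simp only [hom_ρ, toCovering_pt_over] at e1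
    have hω : ω = ω' := by
      rw [← Quot.out_eq ω, ← Quot.out_eq ω']
      exact (BTemp.cl_eq_cl_iff _ _ _).mpr ⟨g, e1⟩
    subst hω
    -- `g ∈ Stab(x_ω)` acts on the point fibre and carries `φ⁻¹ x_o` to `φ⁻¹ x_{o′}`; apply `φ`
    have hs : ((S₀.toCovering.obj U).SV ⟨v, ω⟩).obj.ρ (⟨g, e1⟩ : BTemp.stab (S₀.SV v) (Quot.out ω))
        ((φ.inv.fV ⟨v, ω⟩).hom.hom (Quot.out o)) = (φ.inv.fV ⟨v, ω⟩).hom.hom (Quot.out o') :=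
      Subtype.ext hg
    rw [← hom_ρ] at hs
    have ho : (T'.SV ⟨v, ω⟩).obj.ρ (⟨g, e1⟩ : BTemp.stab (S₀.SV v) (Quot.out ω)) (Quot.out o) = Quot.out o' :=
      iso_hom_injective_V φ.symm ⟨v, ω⟩ hs
    have hoo : o = o' := by
      rw [← Quot.out_eq o, ← Quot.out_eq o']
      exact (BTemp.cl_eq_cl_iff _ _ _).mpr ⟨_, ho⟩
    rw [hoo]
  · rintro ⟨v, Ω⟩
    induction Ω using Quot.ind with
    | mk w =>
      -- move `w` into the fibre over the base point of the orbit of its image in `S₀,v`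
      obtain ⟨g, hg⟩ := (BTemp.cl_eq_cl_iff (S₀.SV v) ((U.hom.fV v).hom.hom w)
        (Quot.out (BTemp.cl (S₀.SV v) ((U.hom.fV v).hom.hom w)))).mp (Quot.out_eq _).symm
      let t : ((S₀.toCovering.obj U).SV ⟨v, BTemp.cl (S₀.SV v) ((U.hom.fV v).hom.hom w)⟩).obj.V :=
        ⟨(U.left.SV v).obj.ρ g w,
          show ((U.hom.fV v).hom.hom ((U.left.SV v).obj.ρ g w) : (S₀.SV v).obj.V) = _ by rw [hom_ρ]; exact hg⟩
      refine ⟨⟨⟨v, BTemp.cl (S₀.SV v) ((U.hom.fV v).hom.hom w)⟩,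
        BTemp.cl (T'.SV _) ((φ.hom.fV _).hom.hom t)⟩, ?_⟩
      rw [pointLift_vertexMap]
      change (⟨v, BTemp.cl (U.left.SV v) ((φ.inv.fV _).hom.hom
          (Quot.out (BTemp.cl (T'.SV _) ((φ.hom.fV _).hom.hom t)))).1⟩ : U.left.coveringSemiGraph.Vertex) =
        ⟨v, BTemp.cl (U.left.SV v) w⟩
      congr 1
      -- the base point of the orbit of `φ t` is `s · φ t`, `s ∈ Stab(x_ω)`
      obtain ⟨s, hs⟩ := (BTemp.cl_eq_cl_iff (T'.SV _) ((φ.hom.fV _).hom.hom t)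
        (Quot.out (BTemp.cl (T'.SV _) ((φ.hom.fV _).hom.hom t)))).mp (Quot.out_eq _).symm
      rw [← hs, ← hom_ρ, iso_inv_hom_apply_V, toCovering_ρV_val, BTemp.cl_ρ]
      exact BTemp.cl_ρ _ _ _

/-- … and bijective on edges. [cite: MochizukiSemiAnbd2006, §2 p.23] -/
theorem pointLift_tower_edgeMap_bijective :
    Function.Bijective (U.left.pointLift (T'.coveringHom.comp S₀.coveringHom).base
      (fun ν => ((φ.inv.fV ν.1).hom.hom (Quot.out ν.2)).1)
      (fun ε => ((φ.inv.fE ε.1).hom.hom (Quot.out ε.2)).1) (S₀.glueCondition_tower U φ)).edgeMap := by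
  constructor
  · rintro ⟨⟨f, ω⟩, o⟩ ⟨⟨f', ω'⟩, o'⟩ hεε
    rw [pointLift_edgeMap, pointLift_edgeMap] at hεε
    obtain ⟨h1, h2⟩ := Sigma.mk.inj_iff.mp hεε
    change f = f' at h1
    subst h1
    have h3 := eq_of_heq h2
    change BTemp.cl (U.left.SE f) ((φ.inv.fE ⟨f, ω⟩).hom.hom (Quot.out o)).1 =
      BTemp.cl (U.left.SE f) ((φ.inv.fE ⟨f, ω'⟩).hom.hom (Quot.out o')).1 at h3
    obtain ⟨g, hg⟩ := (BTemp.cl_eq_cl_iff _ _ _).mp h3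
    have e1 := congrArg (fun t : (U.left.SE f).obj.V => ((U.hom.fE f).hom.hom t : (S₀.SE f).obj.V)) hg
    simp only [hom_ρ, toCovering_ptE_over] at e1
    have hω : ω = ω' := by
      rw [← Quot.out_eq ω, ← Quot.out_eq ω']
      exact (BTemp.cl_eq_cl_iff _ _ _).mpr ⟨g, e1⟩
    subst hω
    have hs : ((S₀.toCovering.obj U).SE ⟨f, ω⟩).obj.ρ (⟨g, e1⟩ : BTemp.stab (S₀.SE f) (Quot.out ω))
        ((φ.inv.fE ⟨f, ω⟩).hom.hom (Quot.out o)) = (φ.inv.fE ⟨f, ω⟩).hom.hom (Quot.out o') :=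
      Subtype.ext hg
    rw [← hom_ρ] at hs
    have ho : (T'.SE ⟨f, ω⟩).obj.ρ (⟨g, e1⟩ : BTemp.stab (S₀.SE f) (Quot.out ω)) (Quot.out o) = Quot.out o' :=
      iso_hom_injective_E φ.symm ⟨f, ω⟩ hs
    have hoo : o = o' := by
      rw [← Quot.out_eq o, ← Quot.out_eq o']
      exact (BTemp.cl_eq_cl_iff _ _ _).mpr ⟨_, ho⟩
    rw [hoo]
  · rintro ⟨f, Ω⟩
    induction Ω using Quot.ind with
    | mk w =>
      obtain ⟨g, hg⟩ := (BTemp.cl_eq_cl_iff (S₀.SE f) ((U.hom.fE f).hom.hom w)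
        (Quot.out (BTemp.cl (S₀.SE f) ((U.hom.fE f).hom.hom w)))).mp (Quot.out_eq _).symm
      let t : ((S₀.toCovering.obj U).SE ⟨f, BTemp.cl (S₀.SE f) ((U.hom.fE f).hom.hom w)⟩).obj.V :=
        ⟨(U.left.SE f).obj.ρ g w,
          show ((U.hom.fE f).hom.hom ((U.left.SE f).obj.ρ g w) : (S₀.SE f).obj.V) = _ by rw [hom_ρ]; exact hg⟩
      refine ⟨⟨⟨f, BTemp.cl (S₀.SE f) ((U.hom.fE f).hom.hom w)⟩,
        BTemp.cl (T'.SE _) ((φ.hom.fE _).hom.hom t)⟩, ?_⟩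
      rw [pointLift_edgeMap]
      change (⟨f, BTemp.cl (U.left.SE f) ((φ.inv.fE _).hom.hom
          (Quot.out (BTemp.cl (T'.SE _) ((φ.hom.fE _).hom.hom t)))).1⟩ : U.left.coveringSemiGraph.Edge) =
        ⟨f, BTemp.cl (U.left.SE f) w⟩
      congr 1
      obtain ⟨s, hs⟩ := (BTemp.cl_eq_cl_iff (T'.SE _) ((φ.hom.fE _).hom.hom t)
        (Quot.out (BTemp.cl (T'.SE _) ((φ.hom.fE _).hom.hom t)))).mp (Quot.out_eq _).symm
      rw [← hs, ← hom_ρ, iso_inv_hom_apply_E, toCovering_ρE_val, BTemp.cl_ρ]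
      exact BTemp.cl_ρ _ _ _

/-! ## §4. The tower is the covering of ONE object of `B^cov(K)` -/

/-- **`𝒢_{T′} → 𝒢_{S₀} → K` is isomorphic OVER `K` to `𝒢_U → K`** for `U → S₀` in `B^cov(K)` with `toCovering U ≅ T′`: the
total object of a relative covering realises the tower. [cite: MochizukiSemiAnbd2006, Def 3.5(i) p.37] -/
theorem nonempty_isoOver_tower (φ : S₀.toCovering.obj U ≅ T') :
    Nonempty (Hom.IsoOver (T'.coveringHom.comp S₀.coveringHom) U.left.coveringHom) :=
  ⟨pointIsoOver (T'.coveringHom.comp S₀.coveringHom) U.left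
    (fun ν => ((φ.inv.fV ν.1).hom.hom (Quot.out ν.2)).1) (fun ε => ((φ.inv.fE ε.1).hom.hom (Quot.out ε.2)).1)
    (S₀.glueCondition_tower U φ) (S₀.stabCondition_tower U φ) (S₀.pointAligned_tower U φ)
    (T'.isProper_coveringHom.comp S₀.isProper_coveringHom)
    (S₀.pointLift_tower_vertexMap_bijective U φ) (S₀.pointLift_tower_edgeMap_bijective U φ)⟩

/-- **`𝒢_{toCovering U} → 𝒢_{S₀} → K` is isomorphic over `K` to `𝒢_U → K`**: the covering semi-graph of anabelioids of the
image of `U → S₀` under abc-iut-L3-d6's comparison functor `B^cov(K)_{S₀} ⥤ B^cov(𝒢_{S₀})`, read over `K`, is that of the total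
object `U.left`. [cite: MochizukiSemiAnbd2006, Prop 3.6(v) p.39] -/
theorem nonempty_isoOver_toCovering :
    Nonempty (Hom.IsoOver ((S₀.toCovering.obj U).coveringHom.comp S₀.coveringHom) U.left.coveringHom) :=
  S₀.nonempty_isoOver_tower U (Iso.refl _)

/-- **A covering of a covering is a covering, at the `B^cov` carriers: EVERY tower `𝒢_{T′} → 𝒢_{S₀} → K` (`T′ ∈ B^cov(𝒢_{S₀})`)
is isomorphic over `K` to the covering `𝒢_S → K` of ONE object `S ∈ B^cov(K)`** — `S := (pre T′).left`, abc-iut-L3-d6's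
essential preimage under `B^cov(K)_{S₀} ≌ B^cov(𝒢_{S₀})` (§2 p.23 `B(𝒢′) = B(𝒢)_{𝒢′}`, Prop 3.6 (v)) — FINITE when `S₀` and `T′`
are (abc-iut-L3-t5 `isFinite_pre`). [cite: MochizukiSemiAnbd2006, Prop 3.6(v) p.39] -/
theorem exists_covObj_isoOver_tower (T' : CovObj S₀.coveringGraph) :
    ∃ S : CovObj K, Nonempty (Hom.IsoOver (T'.coveringHom.comp S₀.coveringHom) S.coveringHom) ∧
      (S₀.IsFinite → T'.IsFinite → S.IsFinite) :=
  ⟨(S₀.pre T').left, S₀.nonempty_isoOver_tower (S₀.pre T') (S₀.preIso T'), fun h₀ h' => S₀.isFinite_pre h₀ T' h'⟩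

end CovObj

/-! ## §5. Prop 4.4 (i) with ONE finite étale covering `K̃ = 𝒢_S → K` -/

namespace Hom

variable {H K : ProfiniteSemiGraph.{u}} (ψ : Hom H K) (θ : ψ.ConjugatorFamily)

/-- **Prop 4.4 (i), GENUINE at the profinite carriers, with print's single finite étale covering `K̃ → K`.**  For `ψ : H → K` with
`𝔾_H`, `𝔾_K` finite, `H` totally aloof, `K` quasi-coherent and `ψ` locally open with injective constituents: there is a finite
tempered `S₀ ∈ B^cov(K)` over which `ψ₀ : 𝒢'_{ψ^*S₀} → 𝒢_{S₀}` is locally trivial with immersive base, and for every family of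
2-cells `θ₀` of `ψ₀` a finite graph-covering `π : B′ → 𝔾_{S₀}` with: `𝒢''_{ψ₀^*S_π} → 𝒢_{S_π}` LOCALLY TRIVIAL, its underlying
morphism an EMBEDDING on every connected sub-semi-graph of the covering semi-graph `𝔾''_{ψ₀^*S_π}` (Def 4.1 (ii)), AND the tower
`𝒢_{S_π} → 𝒢_{S₀} → K` isomorphic over `K` to `𝒢_S → K` for ONE FINITE `S ∈ B^cov(K)` — print's «finite étale covering `K̃ → K`».
Displayed: the hypotheses (print: finite objects of `Loc(𝔾, Γ)`, Prop 4.3 (i)); no `Loc` dressing.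
[cite: MochizukiSemiAnbd2006, Prop 4.4 (i), p. 54] -/
theorem prop44i_oneObject_of_isQuasiCoherent (hH : H.graph.IsFinite) (hK : K.graph.IsFinite) (hHa : H.IsTotallyAloof)
    (hqc : K.IsQuasiCoherent) (hψ : ψ.IsLocallyOpen)
    (hinjV : ∀ w, Function.Injective (ψ.hV w)) (hinjE : ∀ e', Function.Injective (ψ.hE e')) :
    ∃ S₀ : CovObj K, S₀.IsFinite ∧ S₀.HasNonemptyFibres ∧ S₀.IsTempered ∧
      (ψ.covPullbackSnd θ S₀).IsLocallyTrivial ∧ SemiGraph.IsImmersion (ψ.covPullbackSnd θ S₀).base ∧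
      ∀ θ₀ : (ψ.covPullbackSnd θ S₀).ConjugatorFamily,
      ∃ (B' : SemiGraph.{u}) (π : B' ⟶ S₀.coveringGraph.graph) (hπ : SemiGraph.IsExcision π) (hp : SemiGraph.IsProper π)
        (_ : ∀ v, Countable (SemiGraph.Hom.VertexFiber π v)) (_ : ∀ e, Countable (SemiGraph.Hom.EdgeFiber π e)),
        B'.IsFinite ∧ SemiGraph.IsFiniteGraphCovering π ∧
        (CovObj.ofSemiGraphCovering π hπ hp).IsFinite ∧ (CovObj.ofSemiGraphCovering π hπ hp).IsLocallyTrivial ∧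
        ((ψ.covPullbackSnd θ S₀).covPullbackSnd θ₀ (CovObj.ofSemiGraphCovering π hπ hp)).IsLocallyTrivial ∧
        (∀ C : ((((ψ.covPullbackSnd θ S₀).covPullbackWith θ₀).obj (CovObj.ofSemiGraphCovering π hπ hp)).coveringSemiGraph).Subgraph,
          C.toSemiGraph.IsConnected →
            SemiGraph.IsEmbedding (C.ι ≫ ((ψ.covPullbackSnd θ S₀).covPullbackSnd θ₀ (CovObj.ofSemiGraphCovering π hπ hp)).base)) ∧
        ∃ S : CovObj K, S.IsFinite ∧
          Nonempty (Hom.IsoOver ((CovObj.ofSemiGraphCovering π hπ hp).coveringHom.comp S₀.coveringHom) S.coveringHom) := by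
  obtain ⟨S₀, hfin, hne, htemp, hlt, himm, hrest⟩ := ψ.prop44i_embedding_of_isQuasiCoherent θ hH hK hHa hqc hψ hinjV hinjE
  refine ⟨S₀, hfin, hne, htemp, hlt, himm, fun θ₀ => ?_⟩
  obtain ⟨B', π, hπ, hp, hcV, hcE, hB', hfgc, hfin₁, hlt₁, hlt₂, hemb⟩ := hrest θ₀
  obtain ⟨S, hS, hSfin⟩ := S₀.exists_covObj_isoOver_tower (CovObj.ofSemiGraphCovering π hπ hp)
  exact ⟨B', π, hπ, hp, hcV, hcE, hB', hfgc, hfin₁, hlt₁, hlt₂, hemb, S, hSfin hfin hfin₁, hS⟩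

end Hom



end ProfiniteSemiGraph

end Literature.AnabelianGeometry.SemiGraphs

end
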